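import Summits.AnomalousDissipation.AnomalousDissipation.Theorems.SolenoidalFractalHomogenisationLagrangianCarrierConstructionTowerWindows
import HarnessLib

/-!
# K3L `LagrangianCarrierConstruction` (stmt-AnomalousDissipation-24913), line `birth`: iterated space derivatives of the time slices of a
# jointly smooth field — the slice formula and uniform bounds on compact time slabs (helper; `--supports stmt-AnomalousDissipation-24913`)

Summits-side helper file (everything proved; no definitions, no named facts). Technical bricks for the derivative-bound clauses (L3b),
(F1c) of `LevelRegular`: (1) if `f : ℝ × V → F` is `C^n` on a closed slab `[a, b] × V`, the `i`-th (`i ≤ n`) space derivative of the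
slice `y ↦ f (t, y)` is the joint `i`-th derivative within the slab composed with the inclusion `y ↦ (0, y)`
(`iteratedFDeriv_slice_eq`; Mathlib's `ContinuousLinearMap.iteratedFDerivWithin_comp_right` after a translation), hence jointly
continuous in `(t, y)` on the slab; (2) so, when the slices are lattice periodic, `‖D^i_y f(t, ·)‖` is bounded on `[a, b] × ℝᵈ`
(`exists_bound_iteratedFDeriv_slab`); (3) one-sided slab bounds at every time give bounds on every compact time interval
(`exists_bound_Icc_of_one_sided`, a finite subcover). Infrastructure for route-1's rung leaf F-D1.A0 (a frontier FORMAL rung);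
NOT a proof of anomalous dissipation.
-/

set_option linter.dupNamespace false

noncomputable section

namespace Summit.AnomalousDissipation.AnomalousDissipation.Theorems.SolenoidalFractalHomogenisation.LagrangianCarrierConstruction

open Set Function Filter Topology
open scoped Pointwise

variable {V : Type*} [NormedAddCommGroup V] [NormedSpace ℝ V] {F : Type*} [NormedAddCommGroup F] [NormedSpace ℝ F]

omit [NormedSpace ℝ V] in
/-- Translating the time interval of a slab. [folklore] -/
theorem vadd_Icc_prod_univ (t a b : ℝ) :
    ((t, (0 : V)) +ᵥ (Icc (a - t) (b - t) ×ˢ (univ : Set V))) = Icc a b ×ˢ univ := by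
  ext q
  simp only [Set.mem_vadd_set, mem_prod, mem_univ, and_true, mem_Icc]
  constructor
  · rintro ⟨p, hp, rfl⟩
    simp only [vadd_eq_add, Prod.fst_add]
    constructor <;> linarith [hp.1, hp.2]
  · intro hq
    refine ⟨q - (t, (0 : V)), ?_, ?_⟩
    · simp only [Prod.fst_sub]
      constructor <;> linarith [hq.1, hq.2]
    · simp

/-- **The slice formula.** On a closed slab where `f` is jointly `C^n`, the `i`-th space derivative of a time slice is the joint
`i`-th derivative within the slab precomposed with the inclusion `y ↦ (0, y)`. [folklore] -/
theorem iteratedFDeriv_slice_eq {f : ℝ × V → F} {a b : ℝ} (hab : a < b) {n i : ℕ} (hi : i ≤ n)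
    (hf : ContDiffOn ℝ n f (Icc a b ×ˢ univ)) {t : ℝ} (ht : t ∈ Icc a b) (y : V) :
    iteratedFDeriv ℝ i (fun y => f (t, y)) y =
      (iteratedFDerivWithin ℝ i f (Icc a b ×ˢ univ) (t, y)).compContinuousLinearMap fun _ => ContinuousLinearMap.inr ℝ ℝ V := by
  have hS' := vadd_Icc_prod_univ (V := V) t a b
  have hslice : (fun y => f (t, y)) = (fun q : ℝ × V => f ((t, (0 : V)) + q)) ∘ (ContinuousLinearMap.inr ℝ ℝ V) := by
    funext y
    simp
  have hg : ContDiffOn ℝ n (fun q : ℝ × V => f ((t, (0 : V)) + q)) (Icc (a - t) (b - t) ×ˢ (univ : Set V)) := by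
    refine hf.comp (contDiff_const.add contDiff_id).contDiffOn fun q hq => ?_
    rw [← hS']
    exact Set.vadd_mem_vadd_set hq
  have hs'u : UniqueDiffOn ℝ (Icc (a - t) (b - t) ×ˢ (univ : Set V)) := (uniqueDiffOn_Icc (by linarith)).prod uniqueDiffOn_univ
  have hpre : (ContinuousLinearMap.inr ℝ ℝ V) ⁻¹' (Icc (a - t) (b - t) ×ˢ (univ : Set V)) = univ := by
    ext y
    simp only [mem_preimage, ContinuousLinearMap.inr_apply, mem_prod, mem_Icc, mem_univ, and_true, iff_true]
    constructor <;> linarith [ht.1, ht.2]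
  have hy : (ContinuousLinearMap.inr ℝ ℝ V) y ∈ Icc (a - t) (b - t) ×ˢ (univ : Set V) := by
    rw [← mem_preimage, hpre]; exact mem_univ _
  have key := ContinuousLinearMap.iteratedFDerivWithin_comp_right (i := i) _ hg hs'u (by rw [hpre]; exact uniqueDiffOn_univ) hy
    (by exact_mod_cast hi)
  rw [hpre, iteratedFDerivWithin_univ] at key
  rw [hslice, key]
  congr 1
  rw [iteratedFDerivWithin_comp_add_left, hS', show ((t, (0 : V)) + (ContinuousLinearMap.inr ℝ ℝ V) y) = (t, y) by simp]

/-- The space derivatives of the slices are jointly continuous on the slab. [folklore] -/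
theorem continuousOn_iteratedFDeriv_slice {f : ℝ × V → F} {a b : ℝ} (hab : a < b) {n i : ℕ} (hi : i ≤ n)
    (hf : ContDiffOn ℝ n f (Icc a b ×ˢ univ)) :
    ContinuousOn (fun p : ℝ × V => iteratedFDeriv ℝ i (fun y => f (p.1, y)) p.2) (Icc a b ×ˢ univ) := by
  have hSu : UniqueDiffOn ℝ (Icc a b ×ˢ (univ : Set V)) := (uniqueDiffOn_Icc hab).prod uniqueDiffOn_univ
  have hc := (ContinuousMultilinearMap.continuous_precomp (F := F) (fun _ : Fin i => ContinuousLinearMap.inr ℝ ℝ V)).comp_continuousOn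
    (hf.continuousOn_iteratedFDerivWithin (by exact_mod_cast hi) hSu)
  refine hc.congr fun p hp => ?_
  simp only [comp_apply]
  exact iteratedFDeriv_slice_eq hab hi hf hp.1 p.2

variable {d : Type*} [Fintype d] [DecidableEq d]

/-- **Uniform bound on a slab.** If `f` is jointly `C^n` on `[a, b] × ℝᵈ` and its slices are lattice periodic, then every space
derivative of order `i ≤ n` of the slices is bounded on `[a, b] × ℝᵈ`. [folklore] -/
theorem exists_bound_iteratedFDeriv_slab {f : ℝ × EuclideanSpace ℝ d → F} {a b : ℝ} (hab : a < b) {n i : ℕ} (hi : i ≤ n)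
    (hf : ContDiffOn ℝ n f (Icc a b ×ˢ univ))
    (hper : ∀ t ∈ Icc a b, ∀ (z : EuclideanSpace ℝ d) (j : d), f (t, z + EuclideanSpace.single j 1) = f (t, z)) :
    ∃ C, ∀ t ∈ Icc a b, ∀ y, ‖iteratedFDeriv ℝ i (fun y => f (t, y)) y‖ ≤ C := by
  refine exists_bound_slab_of_isLatticePeriodic (w := fun t y => iteratedFDeriv ℝ i (fun y => f (t, y)) y) ?_ ?_
  · exact continuousOn_iteratedFDeriv_slice hab hi hf
  · intro t ht j z
    show iteratedFDeriv ℝ i (fun y => f (t, y)) (z + EuclideanSpace.single j 1) = iteratedFDeriv ℝ i (fun y => f (t, y)) z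
    rw [← iteratedFDeriv_comp_add_right]
    congr 1
    funext y
    exact hper t ht y j

omit [NormedSpace ℝ F] [Fintype d] [DecidableEq d] in
/-- **From one-sided slab bounds to bounds on compact intervals.** If around every time there are a right slab and a left slab on
which `‖w t y‖` is bounded uniformly in `y`, then `‖w t y‖` is bounded on every `[a, b] × Y` (finite subcover). [folklore] -/
theorem exists_bound_Icc_of_one_sided {Y : Type*} {w : ℝ → Y → F}
    (hR : ∀ r, ∃ ε > 0, ∃ C, ∀ t ∈ Icc r (r + ε), ∀ y, ‖w t y‖ ≤ C)
    (hL : ∀ r, ∃ ε > 0, ∃ C, ∀ t ∈ Icc (r - ε) r, ∀ y, ‖w t y‖ ≤ C) (a b : ℝ) :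
    ∃ C, ∀ t ∈ Icc a b, ∀ y, ‖w t y‖ ≤ C := by
  have hloc : ∀ r, ∃ ε > 0, ∃ C, ∀ t ∈ Icc (r - ε) (r + ε), ∀ y, ‖w t y‖ ≤ C := by
    intro r
    obtain ⟨ε₁, hε₁, C₁, h₁⟩ := hR r
    obtain ⟨ε₂, hε₂, C₂, h₂⟩ := hL r
    refine ⟨min ε₁ ε₂, lt_min hε₁ hε₂, max C₁ C₂, fun t ht y => ?_⟩
    rcases le_or_gt r t with h | h
    · exact (h₁ t ⟨h, le_trans ht.2 (by linarith [min_le_left ε₁ ε₂])⟩ y).trans (le_max_left _ _)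
    · exact (h₂ t ⟨le_trans (by linarith [min_le_right ε₁ ε₂]) ht.1, h.le⟩ y).trans (le_max_right _ _)
  choose ε hε C hC using hloc
  obtain ⟨T, -, hcov⟩ := (isCompact_Icc (a := a) (b := b)).elim_nhds_subcover (fun r => Ioo (r - ε r) (r + ε r))
    (fun r _ => Ioo_mem_nhds (by linarith [hε r]) (by linarith [hε r]))
  refine ⟨∑ r ∈ T, |C r|, fun t ht y => ?_⟩
  obtain ⟨r, hrT, hr⟩ := mem_iUnion₂.mp (hcov ht)
  calc ‖w t y‖ ≤ C r := hC r t ⟨hr.1.le, hr.2.le⟩ y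
    _ ≤ |C r| := le_abs_self _
    _ ≤ ∑ r' ∈ T, |C r'| := Finset.single_le_sum (f := fun r' => |C r'|) (fun _ _ => abs_nonneg _) hrT

end Summit.AnomalousDissipation.AnomalousDissipation.Theorems.SolenoidalFractalHomogenisation.LagrangianCarrierConstruction

end
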